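import Mathlib
import HarnessLib

/-!
# A vector killed by `1 + τ + ⋯ + τ^{p−1}` (`p` prime) generates a `(p−1)`-dimensional cyclic span:
# `δ, τδ, …, τ^{p−2}δ` are linearly independent (Carlson–Toledo 1999 §6: the vanishing space of an
# `A_{p−1}`-degeneration is "`(k−1)`-dimensional", `T = σ_0` cyclic on it)

Family `hodge`, layer `Literature/AlgebraicGeometry/HodgeTheory`. THEOREMS only (Mathlib imports). Part of
the R1 packaging for crux K1 of `Summits/HodgeConjecture/HodgeConjecture/Theses/CyclicUnitaryPowers.lean`
(STUB-PLAN-B2-g19 §2 R1; LANE-D-ROADMAP-Ax-g0 (a)): statement D / B2 record, for each vanishing vector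
`δ`, only `δ ≠ 0` and `(Σ_{i<p} τ^i) δ = 0`; the dimension `p − 1` of the cyclic span `ℚ[τ]·δ` (a field
`ℚ(ζ_p)`-line, the cyclotomic polynomial being irreducible) follows, in the form of the linear independence of
`δ, τδ, …, τ^{p−2}δ`. Written by the prover seat `hodge-nonav-prover-Ax`.

## What is proved (`V` a `ℚ`-space, `τ : V →ₗ[ℚ] V`, `p` prime, `δ ≠ 0`, `Σ_{i<p} τ^i δ = 0`)
* **`linearIndependent_pow_apply_of_sum_eq_zero`** — `(τ^i δ)_{i < p−1}` is linearly independent over `ℚ`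
  (Bézout with the irreducible cyclotomic polynomial `Φ_p = Σ_{i<p} X^i`).
* `pow_apply_mem_span_pow_apply_fin` / `span_pow_apply_eq` — for `τ^p = 1`, every `τ^i δ` lies in the span of
  the first `p − 1` of them: `span {τ^i δ : i ∈ ℕ} = span {τ^i δ : i < p − 1}`.

## References
* [CarlsonToledo1999] J. A. Carlson, D. Toledo, Duke Math. J. 97 (1999), §6 (p. 13: the vanishing space is
  `(k−1)`-dimensional with the cyclic local monodromy `T = σ_0`).
-/

noncomputable section

open Module Polynomial

namespace Literature.AlgebraicGeometry.HodgeTheory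

universe v

variable {V : Type v} [AddCommGroup V] [Module ℚ V]

/-- Evaluating a polynomial in `τ` on `δ`: `(Σ cᵢ Xⁱ)(τ) δ = Σ cᵢ τⁱ δ` for a polynomial given as a finite sum
of monomials. [folklore] -/
private theorem aeval_sum_C_mul_X_pow_apply {ι : Type*} (s : Finset ι) (c : ι → ℚ) (e : ι → ℕ) (τ : V →ₗ[ℚ] V)
    (δ : V) : aeval τ (∑ i ∈ s, C (c i) * X ^ e i) δ = ∑ i ∈ s, c i • (τ ^ e i) δ := by
  rw [map_sum, LinearMap.sum_apply]
  refine Finset.sum_congr rfl fun i _ => ?_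
  rw [map_mul, aeval_C, aeval_X_pow, Module.End.mul_apply, Module.algebraMap_end_apply]

/-- **`δ, τδ, …, τ^{p−2}δ` are linearly independent** when `p` is prime, `δ ≠ 0` and
`(1 + τ + ⋯ + τ^{p−1}) δ = 0`: a non-trivial relation would be a non-zero polynomial `f` of degree `< p − 1` with
`f(τ)δ = 0`, coprime to the irreducible `Φ_p = Σ_{i<p} Xⁱ` (which also kills `δ`), whence `δ = 0` by Bézout.
[cite: CarlsonToledo1999, §6 (p. 13)] -/
theorem linearIndependent_pow_apply_of_sum_eq_zero {τ : V →ₗ[ℚ] V} {p : ℕ} (hp : p.Prime) {δ : V} (hδ : δ ≠ 0)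
    (hsum : ∑ i ∈ Finset.range p, (τ ^ i) δ = 0) :
    LinearIndependent ℚ (fun i : Fin (p - 1) => (τ ^ (i : ℕ)) δ) := by
  haveI : Fact p.Prime := ⟨hp⟩
  rw [Fintype.linearIndependent_iff]
  intro c hc
  by_contra hne
  obtain ⟨i₀, hi₀⟩ := not_forall.1 hne
  -- the relation polynomial
  set f : ℚ[X] := ∑ i : Fin (p - 1), C (c i) * X ^ (i : ℕ) with hf
  have hfδ : aeval τ f δ = 0 := by rw [hf, aeval_sum_C_mul_X_pow_apply]; exact hc
  have hcoeff : ∀ i : Fin (p - 1), f.coeff i = c i := by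
    intro i
    rw [hf, finsetSum_coeff]
    simp only [coeff_C_mul_X_pow]
    rw [Finset.sum_eq_single i]
    · simp
    · intro j _ hji
      rw [if_neg]
      exact fun h => hji (Fin.ext h.symm)
    · intro h; exact absurd (Finset.mem_univ i) h
  have hf0 : f ≠ 0 := fun h => hi₀ (by rw [← hcoeff i₀, h, coeff_zero])
  have hfdeg : f.natDegree < p - 1 := by
    have hle : f.natDegree ≤ p - 2 := by
      rw [hf]
      refine natDegree_sum_le_of_forall_le _ _ fun i _ => ?_
      exact (natDegree_C_mul_X_pow_le (c i) i).trans (by have := i.2; omega)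
    have h2 : 2 ≤ p := hp.two_le
    omega
  -- the cyclotomic polynomial kills `δ` too
  set q : ℚ[X] := cyclotomic p ℚ with hq
  have hqδ : aeval τ q δ = 0 := by
    rw [hq, cyclotomic_prime, map_sum, LinearMap.sum_apply]
    simp only [aeval_X_pow]
    exact hsum
  have hqirr : Irreducible q := cyclotomic.irreducible_rat hp.pos
  have hqdeg : q.natDegree = p - 1 := by rw [hq, natDegree_cyclotomic, Nat.totient_prime hp]
  have hndvd : ¬ q ∣ f := fun hdvd => by
    have := natDegree_le_of_dvd hdvd hf0
    omega
  obtain ⟨a, b, hab⟩ := (hqirr.coprime_iff_not_dvd.2 hndvd)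
  -- Bézout: `a q + b f = 1` evaluated at `τ`, applied to `δ`
  have h1 : aeval τ (a * q + b * f) δ = δ := by rw [hab, map_one, Module.End.one_apply]
  rw [map_add, map_mul, map_mul, LinearMap.add_apply, Module.End.mul_apply, Module.End.mul_apply, hqδ, hfδ,
    map_zero, map_zero, add_zero] at h1
  exact hδ h1.symm

/-- For `τ^p = 1` and `(Σ_{i<p} τ^i) δ = 0`, every `τ^i δ` lies in the span of `δ, τδ, …, τ^{p−2}δ`.
[cite: CarlsonToledo1999, §6 (p. 13)] -/
theorem pow_apply_mem_span_pow_apply_fin {τ : V →ₗ[ℚ] V} {p : ℕ} (hp : 2 ≤ p) (hτ : τ ^ p = 1) {δ : V}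
    (hsum : ∑ i ∈ Finset.range p, (τ ^ i) δ = 0) (i : ℕ) :
    (τ ^ i) δ ∈ Submodule.span ℚ (Set.range fun k : Fin (p - 1) => (τ ^ (k : ℕ)) δ) := by
  -- reduce `i` modulo `p`
  have hper : (τ ^ i) δ = (τ ^ (i % p)) δ := by
    conv_lhs => rw [← Nat.mod_add_div i p, pow_add, pow_mul, hτ, one_pow, mul_one]
  rw [hper]
  set m := i % p with hm
  have hmp : m < p := Nat.mod_lt i (by omega)
  by_cases hlt : m < p - 1
  · exact Submodule.subset_span ⟨⟨m, hlt⟩, rfl⟩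
  · -- `m = p - 1`: `τ^{p-1} δ = - Σ_{k < p-1} τ^k δ`
    have hm1 : m = p - 1 := by omega
    have hsplit : ∑ k ∈ Finset.range (p - 1), (τ ^ k) δ + (τ ^ (p - 1)) δ = 0 := by
      rw [← Finset.sum_range_succ, show p - 1 + 1 = p by omega, hsum]
    have heq : (τ ^ m) δ = -∑ k ∈ Finset.range (p - 1), (τ ^ k) δ := by
      rw [hm1]; exact eq_neg_of_add_eq_zero_right hsplit
    rw [heq]
    refine Submodule.neg_mem _ (Submodule.sum_mem _ fun k hk => ?_)
    exact Submodule.subset_span ⟨⟨k, Finset.mem_range.1 hk⟩, rfl⟩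

/-- **The cyclic span is spanned by the first `p − 1` translates**:
`span_ℚ {τ^i δ : i ∈ ℕ} = span_ℚ {τ^i δ : i < p − 1}` (`τ^p = 1`, `(Σ_{i<p} τ^i) δ = 0`).
[cite: CarlsonToledo1999, §6 (p. 13)] -/
theorem span_pow_apply_eq {τ : V →ₗ[ℚ] V} {p : ℕ} (hp : 2 ≤ p) (hτ : τ ^ p = 1) {δ : V}
    (hsum : ∑ i ∈ Finset.range p, (τ ^ i) δ = 0) :
    Submodule.span ℚ (Set.range fun i : ℕ => (τ ^ i) δ) =
      Submodule.span ℚ (Set.range fun k : Fin (p - 1) => (τ ^ (k : ℕ)) δ) := by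
  refine le_antisymm (Submodule.span_le.2 ?_) (Submodule.span_mono ?_)
  · rintro _ ⟨i, rfl⟩
    exact pow_apply_mem_span_pow_apply_fin hp hτ hsum i
  · rintro _ ⟨k, rfl⟩
    exact ⟨(k : ℕ), rfl⟩

end Literature.AlgebraicGeometry.HodgeTheory

end
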